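import Literature.NumberTheory.Rogawski1990.ArchEndoscopicTransferContinuousGWall        -- ★ LH3-p04 (g2) p849710 (M2-01-curve): brings ★ p849548 (Δ-def-explicit), brick A, (C-bdry-glob); sibling ★ p849938 `…HWallOneSided` (one-sided version)
import HarnessLib

/-!
# (M3-pre♯) Across the `H`-wall `z₀ = z₂` at ANY place: `2 sin ψ · (Δ″-side of Θ)` JUMPS at order 0 but its DERIVATIVE has a TWO-SIDED limit (parity safety at order 1)
# (Rogawski 1990 §4.9 p. 55, §8.2 pp. 119–124; Shelstad 1979 §4; Varadarajan 1989 §6.4 Thms 18, 20, 22)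

Topic `NumberTheory/Rogawski1990`; namespace `Literature.NumberTheory.Rogawski1990`.  THEOREMS ONLY (no `def`, no instance, no notation, no axiom, no named fact, no `sorry`).
Cell `pub/hodgecm-mathlib`, line LH3 (closer stub `stub_N9`, crux H413 = `stmt-HodgeConjecture-24833`), `H`-side input of organ **(M3)** of LH3-plan (g2)'s D2′-SPEC §3∕§3b («H-WALL
`z₀ = z₂`: κ EQUAL across it, the jumps ADD: `2iκ(A)·(R′F)(D)(cayPt)` … = H-side stable jump `2i·Transf(insert w S)(cayPt)`»).  Companions: ★ p849710 (M2-01-curve: the `G`-walls,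
two-sided limits) and ★ `ArchEndoscopicTransferSmoothDefinitePlace` (the `H`-wall at a definite place, two-sided limits).  Here: the SHARP form of ★ p849938
`ArchEndoscopicTransferHWallOneSided` — the order-1 one-sided limits `Bp, Bm` there COINCIDE, because `S = τ·D` along the curve is EVEN in `ψ` (`S′(0) = 0`): D2′-SPEC §3b
addendum «odd k: the HC-jump itself is 0 … parity safety» at `k = 1`, in-house.

SETTING.  Base `z` regular off `w`, `z_{w,0} = z_{w,2} ≠ z_{w,1}`, curve `z^ψ = update z w (i ↦ z_{w,i}e^{i(1,0,−1)_iψ})`, `H`-point `γ_H(z^ψ)` (its 2-block eigenvalues `ζ₀e^{±iψ}`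
coalesce at `ψ = 0`), partners `t(z^ψ∘ρ)`; `G(ψ) := 2 sin ψ · Σ_ρ Δ″(γ_H(z^ψ), t(z^ψ∘ρ))·∫_{G′_∞} Θ(↑↑(g·t(z^ψ∘ρ)·g⁻¹)) dν_∞` — the factor `2 sin ψ` is (up to a unit) the
`H`-root factor `1 − e^{−i(c₀−c₂)}` of the normaliser `R_H`, which tames the `1∕ψ` growth of the unstable orbital integrals at a noncompact wall.

THE MATHEMATICS.  `Δ″_ρ = K_ρ·(τ·D)(γ_H(z^ψ))` (★ p849548) with `(τ·D)(ψ) = S(ψ) = C·(−((ζ₀²)^k(ζ₁ − ζ₀e^{iψ})(ζ₁ − ζ₀e^{−iψ}))∕ζ₁)` ENTIRE (`z₀z₂ = ζ₀²` constant on the curve); so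
`G = S · Σ_ρ K_ρ g_ρ`, `g_ρ = 2 sin ψ·O_ρ` with three limits `Jp_ρ, Jm_ρ, D_ρ` for EVERY partner (noncompact `w`-wall: ★ (C-bdry-glob) p849626; compact: ★ brick A p849649,
`Jp_ρ = Jm_ρ = 0`).  Hence `G(0±) = S(0)·Σ_ρ K_ρ J±_ρ` (a genuine jump) while `G′ = S′·H + S·H′ → 0·(bounded one-sided) + S(0)·Σ_ρ K_ρ D_ρ` from BOTH sides since
`S(ψ) = C·(−((ζ₀²)^k(ζ₁² + ζ₀² − ζ₀ζ₁(e^{iψ} + e^{−iψ})))∕ζ₁)` is even, `S′(0) = 0` (`deriv_comp_neg`).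

WHAT IS PROVED.  **`exists_tendsto_two_sin_mul_sum_archExplicitDelta_mul_integral_splitCurve_hWall_sharp`** (+ `_aux`): `∃ Jp Jm B`, one-sided limits of `G` at `0±` and ONE
two-sided punctured limit of `G′`.
HONEST LABEL: HC_CM is proved only modulo the 7 printed citations (2 remaining: hLiu418 = stmt-HodgeConjecture-24832, h413 = stmt-HodgeConjecture-24833) until rung 0 closes; input of
(M3), pays nothing by itself.

## References
* [Rogawski1990] J. D. Rogawski, *Automorphic Representations of Unitary Groups in Three Variables*, Ann. of Math. Stud. 123 (1990), §4.9 p. 55, §8.2 pp. 119–124.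
* [Shelstad1979] D. Shelstad, *Characters and inner forms of a quasi-split group over ℝ*, Compositio Math. 39 (1979), §4.
* [Varadarajan1989] V. S. Varadarajan, *An Introduction to Harmonic Analysis on Semisimple Lie Groups* (1989), §6.4 Thm 18, Thm 20, Thm 22.
-/

set_option autoImplicit false

noncomputable section

open MeasureTheory Measure Filter Topology NumberField NumberField.InfinitePlace NumberField.mixedEmbedding Equiv Function Set
open Literature.MeasureTheory.Group Literature.NumberTheory.Automorphic Literature.NumberTheory.Automorphic.UnitaryGroup Literature.NumberTheory.GaloisRepresentations
open Literature.LinearAlgebra.Matrix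
open scoped Matrix MatrixGroups Matrix.Norms.Operator ContDiff ComplexConjugate

namespace Literature.NumberTheory.Rogawski1990

section HWall

variable (L : Type) [Field L] [NumberField L] [IsCMField L] (α : Fin 3 → L) (w : {w : InfinitePlace L // IsComplex w})
  [MeasurableSpace (GL (Fin 3) ℂ)] [BorelSpace (GL (Fin 3) ℂ)]
  [MeasurableSpace (arch (↥(maximalRealSubfield L)) L (IsCMField.complexConj L) 3 (Matrix.diagonal α))] [BorelSpace (arch (↥(maximalRealSubfield L)) L (IsCMField.complexConj L) 3 (Matrix.diagonal α))]

variable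
  (γH : ({w : InfinitePlace L // IsComplex w} → Fin 3 → Circle) →
    ↥(UnitaryGroup.arch (↥(maximalRealSubfield L)) L (IsCMField.complexConj L) 2
        (Matrix.of fun i j : Fin 2 => if i.val + j.val + 1 = 2 then (1 : L) else 0)) ×
      ↥(UnitaryGroup.arch (↥(maximalRealSubfield L)) L (IsCMField.complexConj L) 1
        (Matrix.of fun i j : Fin 1 => if i.val + j.val + 1 = 1 then (1 : L) else 0)))
  (hγH : γH = fun z =>
    ((UnitaryGroup.archPiEquivCM 2 L (Matrix.of fun i j : Fin 2 => if i.val + j.val + 1 = 2 then (1 : L) else 0)).symm fun w =>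
        ⟨Matrix.GeneralLinearGroup.mkOfDetNeZero !![(1 : ℂ), 1; 1, -1] UnitaryGroup.det_cayleyTwo_ne_zero *
            UnitaryGroup.circleDiagonal 2 ![z w 0, z w 2] *
          (Matrix.GeneralLinearGroup.mkOfDetNeZero !![(1 : ℂ), 1; 1, -1] UnitaryGroup.det_cayleyTwo_ne_zero)⁻¹,
          UnitaryGroup.cayley_conj_circleDiagonal_mem_archLocal L w _⟩,
      (UnitaryGroup.archPiEquivCM 1 L (Matrix.of fun i j : Fin 1 => if i.val + j.val + 1 = 1 then (1 : L) else 0)).symm fun w =>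
        ⟨UnitaryGroup.circleDiagonal 1 ![z w 1], UnitaryGroup.circleDiagonal_mem_archLocal_antidiagOne L w _⟩))
  (μ : HeckeCharacter L)

include hγH in
open scoped Classical in
/-- (M3-pre♯) with the curve as an equality binder (proof engine; instantiate with `rfl`). [cite: Rogawski1990, §8.2 pp. 122–124] [cite: Shelstad1979, §4] [cite: Varadarajan1989, §6.4 Thm 18, Thm 20, Thm 22] -/
theorem exists_tendsto_two_sin_mul_sum_archExplicitDelta_mul_integral_splitCurve_hWall_sharp_aux
    (νw : ∀ v : {w : InfinitePlace L // IsComplex w}, Measure (archLocal L 3 (Matrix.diagonal α) v)) [∀ v, (νw v).IsHaarMeasure]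
    (hα : ∀ i, α i ≠ 0) (hherm : ∀ i, (IsCMField.complexConj L (α i) : L) = α i)
    (hμω : ∀ x : ideleGroup ↥(maximalRealSubfield L), μ (AdeleRing.ideleBaseChange (↥(maximalRealSubfield L)) L x) = quadraticHeckeCharCM L x)
    (Θ : Matrix (Fin 3) (Fin 3) (mixedSpace L) → ℂ) (hΘ : ContDiff ℝ (⊤ : ℕ∞) Θ)
    (hΘc : HasCompactSupport fun g : arch (↥(maximalRealSubfield L)) L (IsCMField.complexConj L) 3 (Matrix.diagonal α) => Θ ((g : GL (Fin 3) (mixedSpace L)) : Matrix (Fin 3) (Fin 3) (mixedSpace L)))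
    (z : {w : InfinitePlace L // IsComplex w} → Fin 3 → Circle) (hz : ∀ v, v ≠ w → Function.Injective (z v)) (h02 : z w 0 = z w 2) (h01 : z w 0 ≠ z w 1)
    (c : ℝ → Fin 3 → Circle) (hc : c = fun ψ i => z w i * Circle.exp (![(1 : ℝ), 0, -1] i * ψ)) :
    ∃ Jp Jm B : ℂ,
      Tendsto (fun ψ : ℝ => (2 * Real.sin ψ : ℂ) * ∑ ρ : {w : InfinitePlace L // IsComplex w} → Perm (Fin 3),
          archExplicitDelta L (Matrix.diagonal α) (γH fun v => Function.update z w (c ψ) v) μ (archDiagTorus L 3 α fun v => Function.update z w (c ψ) v ∘ ⇑(ρ v)) *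
            ∫ g, Θ (((g * archDiagTorus L 3 α (fun v => Function.update z w (c ψ) v ∘ ⇑(ρ v)) * g⁻¹ :
              arch (↥(maximalRealSubfield L)) L (IsCMField.complexConj L) 3 (Matrix.diagonal α)) : GL (Fin 3) (mixedSpace L)) : Matrix (Fin 3) (Fin 3) (mixedSpace L))
              ∂((Measure.pi νw).map (archPiEquivCM 3 L (Matrix.diagonal α)).symm)) (𝓝[>] 0) (𝓝 Jp) ∧
      Tendsto (fun ψ : ℝ => (2 * Real.sin ψ : ℂ) * ∑ ρ : {w : InfinitePlace L // IsComplex w} → Perm (Fin 3),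
          archExplicitDelta L (Matrix.diagonal α) (γH fun v => Function.update z w (c ψ) v) μ (archDiagTorus L 3 α fun v => Function.update z w (c ψ) v ∘ ⇑(ρ v)) *
            ∫ g, Θ (((g * archDiagTorus L 3 α (fun v => Function.update z w (c ψ) v ∘ ⇑(ρ v)) * g⁻¹ :
              arch (↥(maximalRealSubfield L)) L (IsCMField.complexConj L) 3 (Matrix.diagonal α)) : GL (Fin 3) (mixedSpace L)) : Matrix (Fin 3) (Fin 3) (mixedSpace L))
              ∂((Measure.pi νw).map (archPiEquivCM 3 L (Matrix.diagonal α)).symm)) (𝓝[<] 0) (𝓝 Jm) ∧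
      Tendsto (fun ψ : ℝ => deriv (fun ψ : ℝ => (2 * Real.sin ψ : ℂ) * ∑ ρ : {w : InfinitePlace L // IsComplex w} → Perm (Fin 3),
          archExplicitDelta L (Matrix.diagonal α) (γH fun v => Function.update z w (c ψ) v) μ (archDiagTorus L 3 α fun v => Function.update z w (c ψ) v ∘ ⇑(ρ v)) *
            ∫ g, Θ (((g * archDiagTorus L 3 α (fun v => Function.update z w (c ψ) v ∘ ⇑(ρ v)) * g⁻¹ :
              arch (↥(maximalRealSubfield L)) L (IsCMField.complexConj L) 3 (Matrix.diagonal α)) : GL (Fin 3) (mixedSpace L)) : Matrix (Fin 3) (Fin 3) (mixedSpace L))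
              ∂((Measure.pi νw).map (archPiEquivCM 3 L (Matrix.diagonal α)).symm)) ψ) (𝓝[≠] 0) (𝓝 B) := by
  -- ABBREVIATIONS (opaque, with defining equations): the orbital function `g_ρ`, the sign product `K_ρ`
  obtain ⟨G, hG⟩ : ∃ G : ({w : InfinitePlace L // IsComplex w} → Perm (Fin 3)) → ℝ → ℂ, G = fun (ρ : {w : InfinitePlace L // IsComplex w} → Perm (Fin 3)) (ψ : ℝ) => (2 * Real.sin ψ : ℂ) *
      ∫ g, Θ (((g * archDiagTorus L 3 α (fun v => Function.update z w (c ψ) v ∘ ⇑(ρ v)) * g⁻¹ :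
        arch (↥(maximalRealSubfield L)) L (IsCMField.complexConj L) 3 (Matrix.diagonal α)) : GL (Fin 3) (mixedSpace L)) : Matrix (Fin 3) (Fin 3) (mixedSpace L))
        ∂((Measure.pi νw).map (archPiEquivCM 3 L (Matrix.diagonal α)).symm) := ⟨_, rfl⟩
  obtain ⟨K, hK⟩ : ∃ K : ({w : InfinitePlace L // IsComplex w} → Perm (Fin 3)) → ℤ, ∀ ρ, K ρ =
      (∏ v : {w : InfinitePlace L // IsComplex w}, ((SignType.sign ((v.1.embedding (α ((ρ v).symm 1))).re) : ℤ) * archMajoritySign L (Matrix.diagonal α) v)) :=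
    ⟨fun ρ => _, fun ρ => rfl⟩
  have hGρ : ∀ ρ : {w : InfinitePlace L // IsComplex w} → Perm (Fin 3), G ρ = fun ψ : ℝ => (2 * Real.sin ψ : ℂ) *
      ∫ g, Θ (((g * archDiagTorus L 3 α (fun v => Function.update z w (fun i => z w i * Circle.exp (![(1 : ℝ), 0, -1] i * ψ)) v ∘ ⇑(ρ v)) * g⁻¹ :
        arch (↥(maximalRealSubfield L)) L (IsCMField.complexConj L) 3 (Matrix.diagonal α)) : GL (Fin 3) (mixedSpace L)) : Matrix (Fin 3) (Fin 3) (mixedSpace L))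
        ∂((Measure.pi νw).map (archPiEquivCM 3 L (Matrix.diagonal α)).symm) := by
    intro ρ; subst hc hG; rfl
  have hcψ : ∀ ψ : ℝ, c ψ = fun i => z w i * Circle.exp (![(1 : ℝ), 0, -1] i * ψ) := fun ψ => by subst hc; rfl
  have hreal : ∀ i, (w.1.embedding (α i)).im = 0 := fun i => im_embedding_eq_zero_of_complexConj_eq L w (hherm i)
  have hne : ∀ i, (w.1.embedding (α i)).re ≠ 0 := fun i h =>
    hα i (w.1.embedding.injective (by rw [map_zero]; exact Complex.ext h (hreal i)))
  have h12 : z w 1 ≠ z w 2 := fun h => h01 (h02.trans h.symm)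
  -- (1) PER-PARTNER LIMITS: `Jp, Jm, D`, with `Jp = Jm = 0` at a compact wall
  have hlim : ∀ ρ : {w : InfinitePlace L // IsComplex w} → Perm (Fin 3), ∃ Jp Jm D : ℂ,
      Tendsto (G ρ) (𝓝[>] 0) (𝓝 Jp) ∧ Tendsto (G ρ) (𝓝[<] 0) (𝓝 Jm) ∧ Tendsto (fun ψ => deriv (G ρ) ψ) (𝓝[≠] 0) (𝓝 D) ∧
        (0 < (w.1.embedding (α ((ρ w)⁻¹ 0))).re * (w.1.embedding (α ((ρ w)⁻¹ 2))).re → Jp = 0 ∧ Jm = 0) := by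
    intro ρ
    rw [hGρ ρ]
    rcases lt_or_gt_of_ne (mul_ne_zero (hne ((ρ w)⁻¹ 0)) (hne ((ρ w)⁻¹ 2))) with hnc | hpos
    · obtain ⟨Jp, Jm, D, hJp, hJm, hD⟩ := exists_tendsto_two_sin_mul_integral_comp_conj_archDiagTorus_update_splitCurve_comp L α w νw hα hherm Θ hΘ hΘc z hz h02 h01 ρ hnc
      exact ⟨Jp, Jm, D, hJp, hJm, hD, fun h => absurd hnc (not_lt.mpr h.le)⟩
    · obtain ⟨h0, D, hD⟩ := tendsto_two_sin_mul_integral_comp_conj_archDiagTorus_update_splitCurve_comp_of_pos L α w νw hα hherm Θ hΘ hΘc z hz h02 h01 ρ hpos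
      exact ⟨0, 0, D, h0.mono_left (nhdsWithin_mono _ fun x hx => ne_of_gt hx), h0.mono_left (nhdsWithin_mono _ fun x hx => ne_of_lt hx), hD, fun _ => ⟨rfl, rfl⟩⟩
  choose Jp Jm D hJp hJm hD hcw using hlim
  -- (2) THE LAURENT FORM OF `τ·D` ALONG THE CURVE: `= S(ψ)` with `S` entire (no zero at the `H`-wall: `z₀z₂ = ζ₀²` is constant)
  obtain ⟨k, hk⟩ := exists_archTau_mul_archWeylRatio_cayleyTorus_eq L γH hγH μ hμω
  obtain ⟨Cst, hCst⟩ : ∃ Cst : ℂ, Cst = (∏ v ∈ Finset.univ.erase w, -((((z v 0 : ℂ) * (z v 2 : ℂ)) ^ (k v)) * (((z v 1 : ℂ) - (z v 0 : ℂ)) * ((z v 1 : ℂ) - (z v 2 : ℂ))) / (z v 1 : ℂ))) :=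
    ⟨_, rfl⟩
  obtain ⟨S, hS⟩ : ∃ S : ℝ → ℂ, S = fun ψ : ℝ => Cst * -(((((z w 0 : ℂ) * (z w 0 : ℂ)) ^ (k w)) *
      ((((z w 1 : ℂ) - (z w 0 : ℂ) * Complex.exp (ψ * Complex.I)) * ((z w 1 : ℂ) - (z w 0 : ℂ) * Complex.exp (-(ψ * Complex.I)))))) / (z w 1 : ℂ)) := ⟨_, rfl⟩
  have hS_smooth : ContDiff ℝ (⊤ : ℕ∞) S := by
    have h1 : ContDiff ℝ (⊤ : ℕ∞) (fun ψ : ℝ => (ψ : ℂ)) := Complex.ofRealCLM.contDiff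
    have hA : ContDiff ℝ (⊤ : ℕ∞) (fun ψ : ℝ => Complex.exp (ψ * Complex.I)) := Complex.contDiff_exp.comp (h1.mul contDiff_const)
    have hB : ContDiff ℝ (⊤ : ℕ∞) (fun ψ : ℝ => Complex.exp (-(ψ * Complex.I))) := Complex.contDiff_exp.comp (h1.mul contDiff_const).neg
    rw [hS]
    simp only [div_eq_mul_inv]
    exact contDiff_const.mul ((contDiff_const.mul ((contDiff_const.sub (contDiff_const.mul hA)).mul (contDiff_const.sub (contDiff_const.mul hB)))).mul contDiff_const).neg
  have hc0 : ∀ ψ : ℝ, ((c ψ 0 : Circle) : ℂ) = (z w 0 : ℂ) * Complex.exp (ψ * Complex.I) := by intro ψ; subst hc; simp [Circle.coe_exp]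
  have hc1 : ∀ ψ : ℝ, ((c ψ 1 : Circle) : ℂ) = (z w 1 : ℂ) := by intro ψ; subst hc; simp
  have hc2 : ∀ ψ : ℝ, ((c ψ 2 : Circle) : ℂ) = (z w 0 : ℂ) * Complex.exp (-(ψ * Complex.I)) := by intro ψ; subst hc; simp [Circle.coe_exp, h02, Complex.exp_neg]
  have hT : ∀ ψ : ℝ, archTau L (γH fun v => Function.update z w (c ψ) v) μ * (archWeylRatio L (γH fun v => Function.update z w (c ψ) v) : ℂ) = S ψ := by
    intro ψ
    rw [hk, ← Finset.mul_prod_erase Finset.univ _ (Finset.mem_univ w), Function.update_self, hc0, hc1, hc2,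
      Finset.prod_congr rfl fun v hv => by rw [Function.update_of_ne (Finset.ne_of_mem_erase hv)], hS, hCst]
    have he : Complex.exp (ψ * Complex.I) * Complex.exp (-(ψ * Complex.I)) = 1 := by rw [← Complex.exp_add, add_neg_cancel, Complex.exp_zero]
    have hsq : ((z w 0 : ℂ) * Complex.exp (ψ * Complex.I)) * ((z w 0 : ℂ) * Complex.exp (-(ψ * Complex.I))) = (z w 0 : ℂ) * (z w 0 : ℂ) := by
      linear_combination ((z w 0 : ℂ) * (z w 0 : ℂ)) * he
    rw [hsq]
    ring
  -- (3) `Δ″`-TERMS AND `G = S · H`, `H = Σ_ρ K_ρ g_ρ`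
  have hΔ : ∀ (ρ : {w : InfinitePlace L // IsComplex w} → Perm (Fin 3)) (ψ : ℝ),
      archExplicitDelta L (Matrix.diagonal α) (γH fun v => Function.update z w (c ψ) v) μ (archDiagTorus L 3 α fun v => Function.update z w (c ψ) v ∘ ⇑(ρ v)) =
        (K ρ : ℂ) * S ψ := by
    intro ρ ψ
    rw [archExplicitDelta_cayleyTorus_relabel_eq_mul L α γH hγH μ (fun v => Function.update z w (c ψ) v) ρ, hT ψ, hK ρ]
  have hF : (fun ψ : ℝ => (2 * Real.sin ψ : ℂ) * ∑ ρ : {w : InfinitePlace L // IsComplex w} → Perm (Fin 3),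
          archExplicitDelta L (Matrix.diagonal α) (γH fun v => Function.update z w (c ψ) v) μ (archDiagTorus L 3 α fun v => Function.update z w (c ψ) v ∘ ⇑(ρ v)) *
            ∫ g, Θ (((g * archDiagTorus L 3 α (fun v => Function.update z w (c ψ) v ∘ ⇑(ρ v)) * g⁻¹ :
              arch (↥(maximalRealSubfield L)) L (IsCMField.complexConj L) 3 (Matrix.diagonal α)) : GL (Fin 3) (mixedSpace L)) : Matrix (Fin 3) (Fin 3) (mixedSpace L))
              ∂((Measure.pi νw).map (archPiEquivCM 3 L (Matrix.diagonal α)).symm)) =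
      fun ψ => S ψ * ∑ ρ : {w : InfinitePlace L // IsComplex w} → Perm (Fin 3), (K ρ : ℂ) * G ρ ψ := by
    funext ψ
    rw [Finset.mul_sum, Finset.mul_sum]
    refine Finset.sum_congr rfl fun ρ _ => ?_
    rw [hΔ ρ ψ, hG]
    ring
  rw [hF]
  -- (4) LIMITS OF `H` (one-sided) AND `H′` (two-sided)
  have hTev : ∀ᶠ ψ in 𝓝[≠] (0 : ℝ), Function.Injective (c ψ) := by
    simp only [hcψ]; exact eventually_injective_splitCurve (z w) h02 h01
  have hGdiff : ∀ ρ : {w : InfinitePlace L // IsComplex w} → Perm (Fin 3), ∀ ψ : ℝ, Function.Injective (c ψ) → DifferentiableAt ℝ (G ρ) ψ := by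
    intro ρ ψ hψ
    rw [hGρ ρ]
    rw [hcψ ψ] at hψ
    exact differentiableAt_two_sin_mul_integral_comp_conj_archDiagTorus_update_splitCurve_comp L α w νw hα hherm Θ hΘ hΘc z hz ρ hψ
  have hGT : (𝓝[>] (0 : ℝ)) ≤ 𝓝[≠] 0 := nhdsWithin_mono _ fun x hx => ne_of_gt hx
  have hLT : (𝓝[<] (0 : ℝ)) ≤ 𝓝[≠] 0 := nhdsWithin_mono _ fun x hx => ne_of_lt hx
  have hHp : Tendsto (fun ψ => ∑ ρ : {w : InfinitePlace L // IsComplex w} → Perm (Fin 3), (K ρ : ℂ) * G ρ ψ) (𝓝[>] 0) (𝓝 (∑ ρ, (K ρ : ℂ) * Jp ρ)) :=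
    tendsto_finsetSum _ fun ρ _ => (hJp ρ).const_mul _
  have hHm : Tendsto (fun ψ => ∑ ρ : {w : InfinitePlace L // IsComplex w} → Perm (Fin 3), (K ρ : ℂ) * G ρ ψ) (𝓝[<] 0) (𝓝 (∑ ρ, (K ρ : ℂ) * Jm ρ)) :=
    tendsto_finsetSum _ fun ρ _ => (hJm ρ).const_mul _
  have hHderiv : ∀ ψ : ℝ, Function.Injective (c ψ) →
      HasDerivAt (fun ψ => ∑ ρ : {w : InfinitePlace L // IsComplex w} → Perm (Fin 3), (K ρ : ℂ) * G ρ ψ) (∑ ρ, (K ρ : ℂ) * deriv (G ρ) ψ) ψ :=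
    fun ψ hψ => HasDerivAt.fun_sum fun ρ _ => ((hGdiff ρ ψ hψ).hasDerivAt).const_mul _
  have hH' : Tendsto (fun ψ => deriv (fun ψ => ∑ ρ : {w : InfinitePlace L // IsComplex w} → Perm (Fin 3), (K ρ : ℂ) * G ρ ψ) ψ) (𝓝[≠] 0)
      (𝓝 (∑ ρ, (K ρ : ℂ) * D ρ)) := by
    refine (tendsto_finsetSum _ fun ρ _ => (hD ρ).const_mul (K ρ : ℂ)).congr' ?_
    filter_upwards [hTev] with ψ hψ
    exact ((hHderiv ψ hψ).deriv).symm
  -- (5) `G = S·H`, `G′ = S′H + SH′`, one side at a time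
  have hS0 : Tendsto S (𝓝[≠] 0) (𝓝 (S 0)) := (hS_smooth.continuous.tendsto 0).mono_left nhdsWithin_le_nhds
  have hS1 : ∀ ψ, HasDerivAt S (deriv S ψ) ψ := fun ψ => ((hS_smooth.differentiable (by simp)) ψ).hasDerivAt
  have hS'0 : Tendsto (fun ψ => deriv S ψ) (𝓝[≠] 0) (𝓝 (deriv S 0)) :=
    ((hS_smooth.continuous_deriv (by exact_mod_cast le_top)).tendsto 0).mono_left nhdsWithin_le_nhds
  have hDev : ∀ᶠ ψ in 𝓝[≠] (0 : ℝ), deriv S ψ * (∑ ρ : {w : InfinitePlace L // IsComplex w} → Perm (Fin 3), (K ρ : ℂ) * G ρ ψ) +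
      S ψ * deriv (fun ψ => ∑ ρ : {w : InfinitePlace L // IsComplex w} → Perm (Fin 3), (K ρ : ℂ) * G ρ ψ) ψ =
        deriv (fun ψ => S ψ * ∑ ρ : {w : InfinitePlace L // IsComplex w} → Perm (Fin 3), (K ρ : ℂ) * G ρ ψ) ψ := by
    filter_upwards [hTev] with ψ hψ
    rw [(hHderiv ψ hψ).deriv]
    exact (((hS1 ψ).fun_mul (hHderiv ψ hψ)).deriv).symm
  -- `S` is even along the curve, so `S′(0) = 0`
  have hSev : S = fun ψ => S (-ψ) := by
    funext ψ
    rw [hS]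
    simp only [Complex.ofReal_neg, neg_mul, neg_neg]
    ring
  have hS'00 : deriv S 0 = 0 := by
    have h : deriv S 0 = -deriv S 0 := by
      conv_lhs => rw [hSev]
      rw [deriv_comp_neg, neg_zero]
    exact self_eq_neg.mp h
  have hS'H : Tendsto (fun ψ => deriv S ψ * ∑ ρ : {w : InfinitePlace L // IsComplex w} → Perm (Fin 3), (K ρ : ℂ) * G ρ ψ) (𝓝[≠] 0) (𝓝 0) := by
    have hp := (hS'0.mono_left hGT).mul hHp
    have hm := (hS'0.mono_left hLT).mul hHm
    rw [hS'00, zero_mul] at hp hm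
    rw [← nhdsLT_sup_nhdsGT]
    exact hm.sup hp
  refine ⟨S 0 * ∑ ρ, (K ρ : ℂ) * Jp ρ, S 0 * ∑ ρ, (K ρ : ℂ) * Jm ρ, 0 + S 0 * ∑ ρ, (K ρ : ℂ) * D ρ,
    (hS0.mono_left hGT).mul hHp, (hS0.mono_left hLT).mul hHm, ?_⟩
  exact (hS'H.add (hS0.mul hH')).congr' hDev

include hγH in
open scoped Classical in
/-- **(M3-pre♯) — ACROSS THE `H`-WALL AT ANY PLACE, `2 sin ψ · (Δ″-side)` HAS ONE-SIDED LIMITS AND ITS DERIVATIVE A TWO-SIDED LIMIT.**  Base `z` regular off `w`, `z_{w,0} = z_{w,2} ≠ z_{w,1}`,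
`μ|_{𝔸_{L⁺}^×} = ω`; `G(ψ) = 2 sin ψ · Σ_ρ Δ″(γ_H(z^ψ), t(z^ψ∘ρ))·∫_{G′_∞} Θ(↑↑(g·t(z^ψ∘ρ)·g⁻¹)) dν_∞`: there are `Jp Jm B` with `G → Jp∕Jm` as `ψ → 0±` and `G′ → B` as `ψ → 0`, `ψ ≠ 0` (BOTH sides: `τ·D` is even along the curve).
(The jump `Jp − Jm = S(0)·Σ_ρ K_ρ(Jp_ρ − Jm_ρ)` is the `H`-side datum of (M3); the derivative does not jump — parity safety at order 1.)
[cite: Rogawski1990, §8.2 pp. 122–124; §4.9 p. 55] [cite: Shelstad1979, §4] [cite: Varadarajan1989, §6.4 Thm 18, Thm 20, Thm 22] -/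
theorem exists_tendsto_two_sin_mul_sum_archExplicitDelta_mul_integral_splitCurve_hWall_sharp
    (νw : ∀ v : {w : InfinitePlace L // IsComplex w}, Measure (archLocal L 3 (Matrix.diagonal α) v)) [∀ v, (νw v).IsHaarMeasure]
    (hα : ∀ i, α i ≠ 0) (hherm : ∀ i, (IsCMField.complexConj L (α i) : L) = α i)
    (hμω : ∀ x : ideleGroup ↥(maximalRealSubfield L), μ (AdeleRing.ideleBaseChange (↥(maximalRealSubfield L)) L x) = quadraticHeckeCharCM L x)
    (Θ : Matrix (Fin 3) (Fin 3) (mixedSpace L) → ℂ) (hΘ : ContDiff ℝ (⊤ : ℕ∞) Θ)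
    (hΘc : HasCompactSupport fun g : arch (↥(maximalRealSubfield L)) L (IsCMField.complexConj L) 3 (Matrix.diagonal α) => Θ ((g : GL (Fin 3) (mixedSpace L)) : Matrix (Fin 3) (Fin 3) (mixedSpace L)))
    (z : {w : InfinitePlace L // IsComplex w} → Fin 3 → Circle) (hz : ∀ v, v ≠ w → Function.Injective (z v)) (h02 : z w 0 = z w 2) (h01 : z w 0 ≠ z w 1) :
    ∃ Jp Jm B : ℂ,
      Tendsto (fun ψ : ℝ => (2 * Real.sin ψ : ℂ) * ∑ ρ : {w : InfinitePlace L // IsComplex w} → Perm (Fin 3),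
          archExplicitDelta L (Matrix.diagonal α) (γH fun v => Function.update z w (fun i => z w i * Circle.exp (![(1 : ℝ), 0, -1] i * ψ)) v) μ (archDiagTorus L 3 α fun v => Function.update z w (fun i => z w i * Circle.exp (![(1 : ℝ), 0, -1] i * ψ)) v ∘ ⇑(ρ v)) *
            ∫ g, Θ (((g * archDiagTorus L 3 α (fun v => Function.update z w (fun i => z w i * Circle.exp (![(1 : ℝ), 0, -1] i * ψ)) v ∘ ⇑(ρ v)) * g⁻¹ :
              arch (↥(maximalRealSubfield L)) L (IsCMField.complexConj L) 3 (Matrix.diagonal α)) : GL (Fin 3) (mixedSpace L)) : Matrix (Fin 3) (Fin 3) (mixedSpace L))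
              ∂((Measure.pi νw).map (archPiEquivCM 3 L (Matrix.diagonal α)).symm)) (𝓝[>] 0) (𝓝 Jp) ∧
      Tendsto (fun ψ : ℝ => (2 * Real.sin ψ : ℂ) * ∑ ρ : {w : InfinitePlace L // IsComplex w} → Perm (Fin 3),
          archExplicitDelta L (Matrix.diagonal α) (γH fun v => Function.update z w (fun i => z w i * Circle.exp (![(1 : ℝ), 0, -1] i * ψ)) v) μ (archDiagTorus L 3 α fun v => Function.update z w (fun i => z w i * Circle.exp (![(1 : ℝ), 0, -1] i * ψ)) v ∘ ⇑(ρ v)) *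
            ∫ g, Θ (((g * archDiagTorus L 3 α (fun v => Function.update z w (fun i => z w i * Circle.exp (![(1 : ℝ), 0, -1] i * ψ)) v ∘ ⇑(ρ v)) * g⁻¹ :
              arch (↥(maximalRealSubfield L)) L (IsCMField.complexConj L) 3 (Matrix.diagonal α)) : GL (Fin 3) (mixedSpace L)) : Matrix (Fin 3) (Fin 3) (mixedSpace L))
              ∂((Measure.pi νw).map (archPiEquivCM 3 L (Matrix.diagonal α)).symm)) (𝓝[<] 0) (𝓝 Jm) ∧
      Tendsto (fun ψ : ℝ => deriv (fun ψ : ℝ => (2 * Real.sin ψ : ℂ) * ∑ ρ : {w : InfinitePlace L // IsComplex w} → Perm (Fin 3),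
          archExplicitDelta L (Matrix.diagonal α) (γH fun v => Function.update z w (fun i => z w i * Circle.exp (![(1 : ℝ), 0, -1] i * ψ)) v) μ (archDiagTorus L 3 α fun v => Function.update z w (fun i => z w i * Circle.exp (![(1 : ℝ), 0, -1] i * ψ)) v ∘ ⇑(ρ v)) *
            ∫ g, Θ (((g * archDiagTorus L 3 α (fun v => Function.update z w (fun i => z w i * Circle.exp (![(1 : ℝ), 0, -1] i * ψ)) v ∘ ⇑(ρ v)) * g⁻¹ :
              arch (↥(maximalRealSubfield L)) L (IsCMField.complexConj L) 3 (Matrix.diagonal α)) : GL (Fin 3) (mixedSpace L)) : Matrix (Fin 3) (Fin 3) (mixedSpace L))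
              ∂((Measure.pi νw).map (archPiEquivCM 3 L (Matrix.diagonal α)).symm)) ψ) (𝓝[≠] 0) (𝓝 B) :=
  exists_tendsto_two_sin_mul_sum_archExplicitDelta_mul_integral_splitCurve_hWall_sharp_aux L α w γH hγH μ νw hα hherm hμω Θ hΘ hΘc z hz h02 h01 _ rfl

end HWall

end Literature.NumberTheory.Rogawski1990

end
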